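import Literature.InformationTheory.QuantumCodes.QuantumExpanderReducedWeight
import HarnessLib

/-!
# Quantum expander codes: Fawzi–Grospellier–Leverrier 2018 Lemma 24 and Proposition 11 — the
# small-set-flip decoder corrects every error of weight `≤ (rβ₀/(1+β₀))·min(γ_A n_A, γ_B n_B)` — PROOF

Topic `Literature/InformationTheory/QuantumCodes` (venture QEC, LADDER-QEC Q3/Q4: a certified
adversarial-radius theorem for an EFFICIENT decoder on a whole qLDPC family; step 4 of 4). Source:
FGL18 = arXiv:1711.08351v2, Prop. 11 (§3.2, p0011) and its proof "Proof of (thm:beta)" (§7.1,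
p0018 L131 - p0019 L6); LTZ15 = arXiv:1504.00822v1, Lemma 10 (p0009). Objects: the small-set-flip
decoder of `QuantumExpanderCodes.lean` (`IsSSFStep`, `SSFHalts`, `IsSSFRun`, `runOutput`, `IsSSFDecoder`,
threshold `κ = β₀Δ_B` = Algorithm 2), the repaired named fact `FGL18_proposition11_le` (convention
`Δ_A ≤ Δ_B`; the unrepaired `FGL18_proposition11` is refuted in `QuantumExpanderCodesDegenerate.lean`).

* `exists_smallSet_decrease` — **FGL18 Lemma 24 (modified LTZ15 Lemma 8), PROVED**: if `e ∉ C_Z^⊥` and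
  `|e| ≤ (Δ_A/Δ_B)·min(γ_A n_A, γ_B n_B)` then some `F ∈ 𝓕` has `|σ_X(e)| − |σ_X(e ⊕ F)| ≥ β₀Δ_B|F|`
  (minimiser `E_R` of the weighted size, critical generator for `E_R`, flip `x_a ⊎ x_b`);
* `ssfRun_invariants` — along a complete valid run `κ Σᵢ|Fᵢ| ≤ |σ₀| − |σ_f|` and the final syndrome is
  halting ("`βd_B Σ|F_i| ≤ |σ_X(E_0)| − |σ_X(E_f)|`");
* `hammingNorm_runOutput_le` — `|F₀ ⊕ ⋯ ⊕ F_{f−1}| ≤ Σ|Fᵢ|`; `hammingNorm_expanderHX_mulVec_le` — column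
  weights: `|σ_X(e)| ≤ Δ_B|e|` (uses `Δ_A ≤ Δ_B`);
* `FGL18_proposition11_le_holds` — **FGL18 Proposition 11, PROVED** (discharges the named fact
  `FGL18_proposition11_le`): `|E_f| ≤ |e| + Σ|Fᵢ| ≤ (1+β₀)/β₀·|e| ≤ r·min`, and if `E_f ∉ C_Z^⊥` then
  Lemma 24 exhibits a small set passing the while-condition at the HALTING syndrome — contradiction.
-/

namespace Literature.InformationTheory.QuantumCodes

namespace QuantumExpander

open Finset Matrix

section

variable {A B : Type*} [Fintype A] [Fintype B] [DecidableEq A] [DecidableEq B]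

section Lemma24

/-- **FGL18 Lemma 24 (modified LTZ15 Lemma 8), PROVED** — in the form used by Proposition 11: for a
`(Δ_A, Δ_B)`-biregular, `Δ_A ≤ Δ_B`, `(γ_A, δ_A, γ_B, δ_B)`-expanding `G` with `β₀ > 0` and an error `e`
that is NOT harmless (`e ∉ C_Z^⊥ = rowsp H_Z`) with `|e| ≤ r·min(γ_A n_A, γ_B n_B)`, `r = Δ_A/Δ_B`, some
small set `F ∈ 𝓕` has `|σ_X(e)| − |σ_X(e ⊕ F)| ≥ β₀ Δ_B |F|`. Proof as printed: pass to the
`‖·‖`-minimal representative `E_R` of `e + C_Z^⊥` (same syndrome; `|E_R| ≤ Δ_B‖E_R‖ ≤ Δ_B‖E‖ ≤ (Δ_B/Δ_A)|e|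
≤ min`), take a critical generator for `E_R` (Lemma 23), flip `F = x_a ⊎ x_b`, bound the decrease by the
grid count, use `x + y ≤ 1` from minimality and the elementary inequality `f(x,y) ≥ β₀/r`.
[cite: FawziGrospellierLeverrier2018, Lemma 24 (§7.1, arXiv v2 p0018 L36-130)] [cite: LeverrierTillichZemor2015, Lemma 8 (arXiv v1 p0008 L104-110)] -/
theorem exists_smallSet_decrease (H : Matrix B A (ZMod 2)) {dA dB : ℕ} {γA δA γB δB : ℝ}
    (hreg : IsBiregular H dA dB) (hexp : IsLeftRightExpanding H dA dB γA δA γB δB)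
    (hdA : 0 < dA) (hdB : 0 < dB) (hle : dA ≤ dB) (hδA : 0 < δA) (hδB : 0 < δB)
    (hβ : 0 < betaZero dA dB δA δB)
    (e : (A × A) ⊕ (B × B) → ZMod 2) (he : e ∉ rowSpace (expanderHZ H))
    (hw : (hammingNorm e : ℝ) ≤ (dA : ℝ) / dB * min (γA * Fintype.card A) (γB * Fintype.card B)) :
    ∃ F ∈ smallSets (expanderHZ H),
      betaZero dA dB δA δB * dB * F.card
        ≤ (syndromeDecrease (expanderHX H) (expanderHX H *ᵥ e) F : ℝ) := by
  classical
  -- the weighted-size-minimal representative of the coset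
  obtain ⟨eR, heR, hmin⟩ := exists_wnorm_min (expanderHZ H) (wnorm dA dB) e
  have hsyn : expanderHX H *ᵥ eR = expanderHX H *ᵥ e := by
    have h0 := expanderHX_mulVec_eq_zero_of_mem_rowSpace H heR
    rw [Matrix.mulVec_sub, sub_eq_zero] at h0
    exact h0
  have heR_not : eR ∉ rowSpace (expanderHZ H) := by
    intro h
    apply he
    have : e = eR - (eR - e) := by abel
    rw [this]
    exact Submodule.sub_mem _ h heR
  have heR0 : (supp eR).Nonempty := by
    by_contra h0
    rw [Finset.not_nonempty_iff_eq_empty] at h0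
    apply heR_not
    have hz : eR = 0 := by
      ext q
      by_contra hq
      have : q ∈ supp eR := by simpa [supp] using hq
      rw [h0] at this
      exact Finset.notMem_empty _ this
    rw [hz]; exact Submodule.zero_mem _
  -- `|E_R| ≤ min(γ_A n_A, γ_B n_B)`
  have hdA' : (0 : ℝ) < dA := by exact_mod_cast hdA
  have hdB' : (0 : ℝ) < dB := by exact_mod_cast hdB
  have hcardR : ((supp eR).card : ℝ) ≤ min (γA * Fintype.card A) (γB * Fintype.card B) := by
    have h1 : dA * hammingNorm eR ≤ wnorm dA dB eR := (hammingNorm_le_wnorm dA dB hle eR).1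
    have h2 : wnorm dA dB eR ≤ wnorm dA dB e := hmin e (by simp)
    have h3 : wnorm dA dB e ≤ dB * hammingNorm e := (hammingNorm_le_wnorm dA dB hle e).2
    have h4 : ((dA : ℝ) * hammingNorm eR) ≤ dB * hammingNorm e := by
      exact_mod_cast h1.trans (h2.trans h3)
    have hsupp : (supp eR).card = hammingNorm eR := by simp [supp, hammingNorm]
    rw [hsupp]
    have h5 : (dB : ℝ) * hammingNorm e ≤ dA * min (γA * Fintype.card A) (γB * Fintype.card B) := by
      have h6 := mul_le_mul_of_nonneg_left hw hdB'.le
      have h7 : (dB : ℝ) * ((dA : ℝ) / dB * min (γA * Fintype.card A) (γB * Fintype.card B))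
          = dA * min (γA * Fintype.card A) (γB * Fintype.card B) := by
        field_simp
      linarith
    have h8 : (dA : ℝ) * hammingNorm eR ≤ dA * min (γA * Fintype.card A) (γB * Fintype.card B) :=
      h4.trans h5
    exact le_of_mul_le_mul_left h8 hdA'
  have hcardA : ((supp eR).card : ℝ) ≤ γA * Fintype.card A := hcardR.trans (min_le_left _ _)
  have hcardB : ((supp eR).card : ℝ) ≤ γB * Fintype.card B := hcardR.trans (min_le_right _ _)
  -- a critical generator for `E_R`, and its flip set
  obtain ⟨b, a, Χa, Χb, hc⟩ :=
    exists_isCritical H hreg hexp hdA hdB hδA.le hδB.le (supp eR) heR0 hcardA hcardB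
  refine ⟨critFlip H eR b a Χa Χb, critFlip_mem_smallSets hc, ?_⟩
  have hdec := syndromeDecrease_critFlip_ge hreg hc
  rw [hsyn] at hdec
  -- minimality of `E_R` against `E_R ⊕ g_{ba}`
  have hmin' : dA * (critX H eR b a Χa).card + dB * (critY H eR b a Χb).card ≤ dA * dB := by
    have hrow := wnorm_add_row H hreg eR b a
    have hle' : wnorm dA dB eR ≤ wnorm dA dB (eR + expanderHZ H (b, a)) := by
      refine hmin _ ?_
      have : eR + expanderHZ H (b, a) - e = (eR - e) + expanderHZ H (b, a) := by abel
      rw [this]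
      exact Submodule.add_mem _ heR (expanderHZ_row_mem_rowSpace H b a)
    have hXle : (critX H eR b a Χa).card
        ≤ ((nbrs Hᵀ b).filter fun α => eR (Sum.inl (α, a)) ≠ 0).card := by
      refine Finset.card_le_card fun α hα => ?_
      rw [mem_critX] at hα
      rw [Finset.mem_filter, mem_nbrs, Matrix.transpose_apply]
      exact ⟨hα.1.1, hα.2⟩
    have hYle : (critY H eR b a Χb).card
        ≤ ((nbrs H a).filter fun β => eR (Sum.inr (b, β)) ≠ 0).card := by
      refine Finset.card_le_card fun β hβ => ?_
      rw [mem_critY] at hβ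
      rw [Finset.mem_filter, mem_nbrs]
      exact ⟨hβ.1.1, hβ.2⟩
    have hX' := Nat.mul_le_mul_left dA hXle
    have hY' := Nat.mul_le_mul_left dB hYle
    linarith
  -- the arithmetic
  have hF : ((critFlip H eR b a Χa Χb).card : ℝ)
      = (critX H eR b a Χa).card + (critY H eR b a Χb).card := by
    exact_mod_cast card_critFlip H eR b a Χa Χb
  rw [hF]
  have hβ' : 0 < ((dA : ℝ) / dB) / 2 * (1 - 4 * (δA + δB + (δB - δA) ^ 2)) := by
    unfold betaZero at hβ; exact hβ
  have hkey := key_ineq (X := ((critX H eR b a Χa).card : ℝ)) (Y := ((critY H eR b a Χb).card : ℝ))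
    (za := (Χa.card : ℝ)) (zb := (Χb.card : ℝ)) hdA' (by exact_mod_cast hle) (Nat.cast_nonneg _)
    (Nat.cast_nonneg _) hc.card_Χa_le hc.card_Χb_le (by exact_mod_cast hmin') hβ'
  have hdecR : ((critX H eR b a Χa).card : ℝ) * ((dA : ℝ) - Χb.card - (critY H eR b a Χb).card)
      + ((dB : ℝ) - Χa.card - (critX H eR b a Χa).card) * (critY H eR b a Χb).card
      - (critX H eR b a Χa).card * Χb.card - Χa.card * (critY H eR b a Χb).card
      ≤ (syndromeDecrease (expanderHX H) (expanderHX H *ᵥ e) (critFlip H eR b a Χa Χb) : ℝ) := by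
    exact_mod_cast hdec
  unfold betaZero
  linarith

end Lemma24

end

/-! ### Runs of the small-set-flip decoder -/

section SmallSetFlipRun

/-- Subadditivity of the Hamming weight. [folklore] -/
private theorem hammingNorm_add_le' {ι : Type*} [Fintype ι] (x y : ι → ZMod 2) :
    hammingNorm (x + y) ≤ hammingNorm x + hammingNorm y := by
  have h := hammingDist_triangle (x + y) y 0
  have h1 : hammingDist (x + y) y = hammingNorm x := by
    rw [hammingDist_comm, hammingDist_eq_hammingNorm]
    congr 1; ext i; simp only [Pi.add_apply, Pi.neg_apply]; ring
  rw [hammingDist_zero_right, hammingDist_zero_right, h1] at h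
  exact h


variable {Q C R : Type*} [Fintype Q] [Fintype C] [Fintype R] [DecidableEq Q] [DecidableEq C]

omit [Fintype Q] [Fintype C] [Fintype R] [DecidableEq C] in
/-- The output of a run extended by one flip. [cite: FawziGrospellierLeverrier2018, Algorithm 1 (Êᵢ₊₁ = Êᵢ ⊕ Fᵢ)] -/
theorem runOutput_cons (F : Finset Q) (l : List (Finset Q)) :
    runOutput (F :: l) = flipVec F + runOutput l := by
  simp [runOutput]

omit [Fintype C] [Fintype R] [DecidableEq C] in
/-- The weight of an indicator vector is the size of the set. [cite: FawziGrospellierLeverrier2018, §2.1 (|E|)] -/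
theorem hammingNorm_flipVec (F : Finset Q) : hammingNorm (flipVec F) = F.card := by
  classical
  unfold hammingNorm flipVec
  congr 1
  ext q
  simp

omit [Fintype C] [Fintype R] [DecidableEq C] in
/-- `|F₀ ⊕ ⋯ ⊕ F_{f−1}| ≤ Σ |Fᵢ|`. [cite: FawziGrospellierLeverrier2018, proof of Prop 11 (|E_f| ≤ |E_0| + Σ|F_i|; arXiv v2 p0019 L2-4)] -/
theorem hammingNorm_runOutput_le (l : List (Finset Q)) :
    hammingNorm (runOutput l) ≤ (l.map Finset.card).sum := by
  classical
  induction l with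
  | nil => simp [runOutput]
  | cons F l ih =>
    rw [runOutput_cons, List.map_cons, List.sum_cons]
    exact (hammingNorm_add_le' _ _).trans (by rw [hammingNorm_flipVec]; exact Nat.add_le_add_left ih _)

omit [DecidableEq C] in
/-- **Run invariants of the small-set-flip decoder** (threshold `κ`): a complete valid run from `σ` ends in
a HALTING syndrome `σ_f = σ ⊕ σ_X(F₀ ⊕ ⋯ ⊕ F_{f−1})`, and the flips are paid for by the syndrome weight:
`κ Σᵢ |Fᵢ| ≤ |σ| − |σ_f|` ("Since `|σ_X(E_i)| − |σ_X(E_{i+1})| ≥ β d_B |F_i|, we have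
`β d_B Σ|F_i| ≤ |σ_X(E_0)| − |σ_X(E_f)|`").
[cite: FawziGrospellierLeverrier2018, proof of Prop 11 (§7.1, arXiv v2 p0018 L131-134, p0019 L1-2)] -/
theorem ssfRun_invariants {κ : ℝ} {Hs : Matrix C Q (ZMod 2)} {Hg : Matrix R Q (ZMod 2)}
    {σ : C → ZMod 2} {l : List (Finset Q)} (h : IsSSFRun κ Hs Hg σ l) :
    SSFHalts κ Hs Hg (σ + Hs *ᵥ runOutput l) ∧
      κ * ((l.map Finset.card).sum : ℝ)
        ≤ (hammingNorm σ : ℝ) - hammingNorm (σ + Hs *ᵥ runOutput l) := by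
  induction h with
  | halt hh =>
    simp only [runOutput, List.map_nil, List.sum_nil, Matrix.mulVec_zero, add_zero, Nat.cast_zero,
      mul_zero, sub_self, le_refl, and_true]
    exact hh
  | @step σ F l hF hrest ih =>
    obtain ⟨ih1, ih2⟩ := ih
    have hout : σ + Hs *ᵥ runOutput (F :: l) = (σ + Hs *ᵥ flipVec F) + Hs *ᵥ runOutput l := by
      rw [runOutput_cons, Matrix.mulVec_add, add_assoc]
    rw [hout]
    refine ⟨ih1, ?_⟩
    obtain ⟨_, _, hκ, _⟩ := hF
    rw [syndromeDecrease] at hκ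
    have hκ' : κ * (F.card : ℝ) ≤ (hammingNorm σ : ℝ) - hammingNorm (σ + Hs *ᵥ flipVec F) := by
      have h' := hκ; push_cast at h'; exact h'
    rw [List.map_cons, List.sum_cons, Nat.cast_add, mul_add]
    linarith

end SmallSetFlipRun

variable {A B : Type*} [Fintype A] [Fintype B] [DecidableEq A] [DecidableEq B]

section Proposition11

/-- **Column weights of `H_X`**: every qubit lies in at most `max(Δ_A, Δ_B) = Δ_B` checks (`Δ_A ≤ Δ_B`),
hence `|σ_X(e)| ≤ Δ_B |e|` ("`|σ_X(E_0)| − |σ_X(E_f)| ≤ d_B |E_0|`").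
[cite: FawziGrospellierLeverrier2018, proof of Prop 11 (arXiv v2 p0019 L1-2)] [cite: LeverrierTillichZemor2015, proof of Lemma 10 ("the syndrome σ_X(e) has weight at most Δ_B|e|"; arXiv v1 p0009 L64)] -/
theorem hammingNorm_expanderHX_mulVec_le (H : Matrix B A (ZMod 2)) {dA dB : ℕ} (hreg : IsBiregular H dA dB)
    (hle : dA ≤ dB) (v : (A × A) ⊕ (B × B) → ZMod 2) :
    hammingNorm (expanderHX H *ᵥ v) ≤ dB * hammingNorm v := by
  classical
  -- the support of the syndrome is covered by the columns of the error qubits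
  have hcover : (univ.filter fun c : A × B => (expanderHX H *ᵥ v) c ≠ 0)
      ⊆ (supp v).biUnion fun q => univ.filter fun c : A × B => expanderHX H c q ≠ 0 := by
    intro c hc
    rw [Finset.mem_filter] at hc
    by_contra hnot
    apply hc.2
    rw [Matrix.mulVec, dotProduct]
    refine Finset.sum_eq_zero fun q _ => ?_
    by_cases hq : v q = 0
    · rw [hq, mul_zero]
    · by_cases hH : expanderHX H c q = 0
      · rw [hH, zero_mul]
      · exfalso; apply hnot
        exact Finset.mem_biUnion.2 ⟨q, by simpa [supp] using hq,
          Finset.mem_filter.2 ⟨Finset.mem_univ _, hH⟩⟩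
  -- each column has at most `dB` entries
  have hcol : ∀ q : (A × A) ⊕ (B × B), (univ.filter fun c : A × B => expanderHX H c q ≠ 0).card ≤ dB := by
    intro q
    rcases q with ⟨α, a'⟩ | ⟨b', β'⟩
    · -- checks `(α, β)` with `β ∼ a'`: `dA ≤ dB` of them
      have hsub : (univ.filter fun c : A × B => expanderHX H c (Sum.inl (α, a')) ≠ 0)
          ⊆ (nbrs H a').image fun β => (α, β) := by
        rintro ⟨α'', β⟩ hc
        rw [Finset.mem_filter] at hc
        have h := hc.2
        simp only [expanderHX, HypergraphProduct.zMatrix_apply_inl, Matrix.transpose_apply] at h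
        have hαα : α'' = α := by
          by_contra hne; exact h (by simp [hne])
        subst hαα
        have hβ : H β a' ≠ 0 := by
          intro h0; exact h (by simp [h0])
        exact Finset.mem_image.2 ⟨β, mem_nbrs.2 hβ, rfl⟩
      calc _ ≤ ((nbrs H a').image fun β => (α, β)).card := Finset.card_le_card hsub
        _ ≤ (nbrs H a').card := Finset.card_image_le
        _ = dA := card_nbrs_eq H hreg a'
        _ ≤ dB := hle
    · have hsub : (univ.filter fun c : A × B => expanderHX H c (Sum.inr (b', β')) ≠ 0)
          ⊆ (nbrs Hᵀ b').image fun α => (α, β') := by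
        rintro ⟨α, β''⟩ hc
        rw [Finset.mem_filter] at hc
        have h := hc.2
        simp only [expanderHX, HypergraphProduct.zMatrix_apply_inr] at h
        have hββ : β'' = β' := by
          by_contra hne; exact h (by simp [hne])
        subst hββ
        have hα : H b' α ≠ 0 := by
          intro h0; exact h (by simp [h0])
        exact Finset.mem_image.2 ⟨α, by rw [mem_nbrs, Matrix.transpose_apply]; exact hα, rfl⟩
      calc _ ≤ ((nbrs Hᵀ b').image fun α => (α, β')).card := Finset.card_le_card hsub
        _ ≤ (nbrs Hᵀ b').card := Finset.card_image_le
        _ = dB := card_nbrs_transpose_eq H hreg b'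
  have hsupp : (supp v).card = hammingNorm v := by simp [supp, hammingNorm]
  calc hammingNorm (expanderHX H *ᵥ v)
      = (univ.filter fun c : A × B => (expanderHX H *ᵥ v) c ≠ 0).card := by simp [hammingNorm]
    _ ≤ ((supp v).biUnion fun q => univ.filter fun c : A × B => expanderHX H c q ≠ 0).card :=
        Finset.card_le_card hcover
    _ ≤ ∑ q ∈ supp v, (univ.filter fun c : A × B => expanderHX H c q ≠ 0).card := Finset.card_biUnion_le
    _ ≤ ∑ q ∈ supp v, dB := Finset.sum_le_sum fun q _ => hcol q
    _ = dB * hammingNorm v := by rw [Finset.sum_const, smul_eq_mul, hsupp, mul_comm]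

/-- **Fawzi–Grospellier–Leverrier 2018, Proposition 11, PROVED** (discharges the named fact
`FGL18_proposition11_le`): for a `(Δ_A, Δ_B)`-biregular (`1 ≤ Δ_A ≤ Δ_B`)
`(γ_A, δ_A, γ_B, δ_B)`-left-right-expanding graph with `β₀ > 0`, EVERY small-set-flip decoder with
threshold `β₀ Δ_B` (Algorithm 2, any tie-breaking) corrects EVERY `X`-error of weight
`≤ (rβ₀/(1+β₀)) min(γ_A n_A, γ_B n_B)`, `r = Δ_A/Δ_B`. Proof as printed: along the run
`κ Σ|Fᵢ| ≤ |σ₀| ≤ Δ_B|e|`, so `|E_f| ≤ |e| + Σ|Fᵢ| ≤ (1+β₀)/β₀·|e| ≤ r·min`; if the final error `E_f` were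
not in `C_Z^⊥`, Lemma 24 would give a small set passing the while-condition at the HALTING syndrome.
[cite: FawziGrospellierLeverrier2018, Prop 11 (§3.2, arXiv v2 p0011) and its proof (§7.1, p0018 L131-p0019 L6)] -/
theorem FGL18_proposition11_le_holds : FGL18_proposition11_le := by
  intro A B _ _ _ _ H dA dB γA δA γB δB hreg hexp hdA hdB hle hγA hδA hγB hδB hβ D hD e he
  classical
  set κ : ℝ := betaZero dA dB δA δB * dB with hκ
  obtain ⟨l, hrun, hDσ⟩ := hD (expanderHX H *ᵥ e)
  obtain ⟨hhalt, hsum⟩ := ssfRun_invariants hrun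
  rw [Decoder.Corrects, hDσ]
  by_contra hnot
  have hnot' : runOutput l + e ∉ rowSpace (expanderHZ H) := fun h => hnot (SetLike.mem_coe.2 h)
  -- positivity facts
  have hdB' : (0 : ℝ) < dB := by exact_mod_cast hdB
  have hκ0 : 0 < κ := by rw [hκ]; exact mul_pos hβ hdB'
  -- the flips are paid for by the initial syndrome weight `≤ Δ_B |e|`
  have hσ0 : (hammingNorm (expanderHX H *ᵥ e) : ℝ) ≤ dB * hammingNorm e := by
    exact_mod_cast hammingNorm_expanderHX_mulVec_le H hreg hle e
  have hflips : κ * ((l.map Finset.card).sum : ℝ) ≤ dB * hammingNorm e := by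
    have h0 : (0 : ℝ) ≤ hammingNorm (expanderHX H *ᵥ e + expanderHX H *ᵥ runOutput l) := Nat.cast_nonneg _
    linarith
  -- weight of the final error `E_f = e ⊕ Ê`
  have hEf : (hammingNorm (runOutput l + e) : ℝ)
      ≤ (dA : ℝ) / dB * min (γA * Fintype.card A) (γB * Fintype.card B) := by
    have h1 : (hammingNorm (runOutput l + e) : ℝ) ≤ hammingNorm (runOutput l) + hammingNorm e := by
      exact_mod_cast hammingNorm_add_le' _ _
    have h2 : (hammingNorm (runOutput l) : ℝ) ≤ (l.map Finset.card).sum := by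
      exact_mod_cast hammingNorm_runOutput_le l
    -- `Σ|F_i| ≤ |e|/β₀`
    have h3 : ((l.map Finset.card).sum : ℝ) ≤ hammingNorm e / betaZero dA dB δA δB := by
      rw [le_div_iff₀ hβ]
      have : κ * ((l.map Finset.card).sum : ℝ) = betaZero dA dB δA δB * dB * (l.map Finset.card).sum := by
        rw [hκ]
      nlinarith
    -- `|e| (1 + 1/β₀) = |e| (1+β₀)/β₀ ≤ r·min`
    have h4 : (hammingNorm e : ℝ) + hammingNorm e / betaZero dA dB δA δB
        ≤ (dA : ℝ) / dB * min (γA * Fintype.card A) (γB * Fintype.card B) := by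
      have hb := hβ
      set β := betaZero dA dB δA δB with hβdef
      set M := (dA : ℝ) / dB * min (γA * Fintype.card A) (γB * Fintype.card B) with hM
      -- `he : |e| ≤ (dA/dB) * β/(1+β) * min = β/(1+β) * M`
      have he' : (hammingNorm e : ℝ) ≤ β / (1 + β) * M := by
        rw [hM]
        calc (hammingNorm e : ℝ) ≤ (dA : ℝ) / dB * β / (1 + β) * min (γA * Fintype.card A) (γB * Fintype.card B) := he
          _ = β / (1 + β) * ((dA : ℝ) / dB * min (γA * Fintype.card A) (γB * Fintype.card B)) := by ring
      have h1b : 0 < 1 + β := by linarith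
      have hkey : (hammingNorm e : ℝ) * (1 + β) ≤ β * M := by
        have h := he'
        rw [div_mul_eq_mul_div, le_div_iff₀ h1b] at h
        exact h
      -- conclude: |e| + |e|/β = |e|(1+β)/β ≤ M
      have hrew : (hammingNorm e : ℝ) + hammingNorm e / β = hammingNorm e * (1 + β) / β := by
        field_simp
        ring
      rw [hrew, div_le_iff₀ hb]
      linarith
    linarith
  -- Lemma 24 at the final error: a small set passing the while-condition at the halting syndrome
  obtain ⟨F, hF, hFdec⟩ := exists_smallSet_decrease H hreg hexp hdA hdB hle hδA hδB hβ
    (runOutput l + e) hnot' hEf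
  have hsynf : expanderHX H *ᵥ (runOutput l + e) = expanderHX H *ᵥ e + expanderHX H *ᵥ runOutput l := by
    rw [Matrix.mulVec_add, add_comm]
  rw [hsynf] at hFdec
  have hFpos : (0 : ℝ) < F.card := by exact_mod_cast card_pos_of_mem_smallSets hF
  have hdecpos : 0 < syndromeDecrease (expanderHX H) (expanderHX H *ᵥ e + expanderHX H *ᵥ runOutput l) F := by
    have : (0 : ℝ) < syndromeDecrease (expanderHX H) (expanderHX H *ᵥ e + expanderHX H *ᵥ runOutput l) F :=
      lt_of_lt_of_le (mul_pos hκ0 hFpos) hFdec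
    exact_mod_cast this
  exact hhalt F hF ⟨hdecpos, hFdec⟩

end Proposition11

end QuantumExpander

end Literature.InformationTheory.QuantumCodes
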